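import Summits.AtomisticToContinuum.HydrodynamicLimit.Theorems.CollisionIsometryCLTMacroClosureStubLedgerScaling
import Literature.Analysis.FunctionSpaces.FlatTorus
import Mathlib.Topology.UniformSpace.HeineCantor
import Mathlib.Topology.MetricSpace.Pseudo.Pi
import Mathlib.Analysis.Normed.Group.AddCircle
import HarnessLib

/-!
# Cube corners, uniform continuity and two elementary estimates (support for `JaynesSqueeze.BlockGibbs`)

Support file (`--supports stmt-AtomisticToContinuum-13462`) collecting the profile-level ingredients of
the time-zero certificate `blockGibbs_timeZero` (`JaynesSqueezeBlockGibbsTimeZero`):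

* `norm_sub_corner_le`, `dist_corner_le` — the corner `(⌊m · repr x i⌋₊ / m)ᵢ` of the cube of the
  `BlockGibbs` partition containing `x` is within `1/m` of `x` (sup metric of `𝕋³`);
* `exists_forall_dist_lt_of_continuous` — Heine–Cantor on the compact torus in `ε`–`δ` form;
  `exists_pos_forall_le_of_continuous` — positive minimum of a continuous positive function;
* `log_localGibbsProfile_sub` — the pointwise decomposition of the log-ratio of two local Gibbs
  profiles `log prof₁ − log prof₂ = (log a₁ − log a₂) + 3/2 (log θ₂ − log θ₁) + ‖v − u₂‖²/(2θ₂) − ‖v − u₁‖²/(2θ₁)`;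
* `log_sub_log_le_of_sub_le`, `weightBound_of_close` — the two scalar estimates turning
  `η`-closeness of the sampled parameters into the per-particle entropy cost `O(η)`.

No new definitions.
-/

noncomputable section

open MeasureTheory Filter Set Topology

namespace Summit.AtomisticToContinuum.HydrodynamicLimit.Theorems.BlockGibbsLine

open Literature.MathematicalPhysics.KineticTheory Literature.Analysis.FluidPDE
open Literature.Analysis.FunctionSpaces

/-! ## Cube corners -/

/-- A point of `𝕋³` is the projection of its fundamental-domain representative, coordinatewise.
[folklore] -/
theorem apply_eq_coe_repr (x : T3) (i : Fin 3) : x i = ((Torus.repr x i : ℝ) : UnitAddCircle) := by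
  have h := congrFun (Torus.proj_repr x) i
  exact h.symm

/-- **The cube corner is `1/m`-close**: for `m > 0`, the `i`-th coordinate of `x` is within `1/m`
(circle distance) of `⌊m · repr x i⌋ / m`. [folklore] -/
theorem norm_sub_corner_le {m : ℕ} (hm : 0 < m) (x : T3) (i : Fin 3) :
    ‖x i - (((⌊(m : ℝ) * Torus.repr x i⌋₊ : ℝ) / m : ℝ) : UnitAddCircle)‖ ≤ 1 / m := by
  have hm' : (0 : ℝ) < m := by exact_mod_cast hm
  set r : ℝ := Torus.repr x i with hr
  have hr0 : 0 ≤ r := (Torus.repr_apply_mem_Ico x i).1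
  have hk1 : (⌊(m : ℝ) * r⌋₊ : ℝ) ≤ m * r := Nat.floor_le (mul_nonneg hm'.le hr0)
  have hk2 : (m : ℝ) * r < ⌊(m : ℝ) * r⌋₊ + 1 := Nat.lt_floor_add_one _
  have hd0 : 0 ≤ r - ⌊(m : ℝ) * r⌋₊ / m := by
    rw [sub_nonneg, div_le_iff₀ hm']; linarith
  have hd1 : r - ⌊(m : ℝ) * r⌋₊ / m ≤ 1 / m := by
    rw [le_div_iff₀ hm', sub_mul, div_mul_cancel₀ _ hm'.ne']; linarith
  rw [apply_eq_coe_repr x i, ← hr, ← AddCircle.coe_sub, UnitAddCircle.norm_eq]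
  calc |r - ⌊(m : ℝ) * r⌋₊ / m - round (r - ⌊(m : ℝ) * r⌋₊ / m)|
      ≤ |r - ⌊(m : ℝ) * r⌋₊ / m - ((0 : ℤ) : ℝ)| := round_le _ 0
    _ = r - ⌊(m : ℝ) * r⌋₊ / m := by rw [Int.cast_zero, sub_zero, abs_of_nonneg hd0]
    _ ≤ 1 / m := hd1

/-- The cube corner is `1/m`-close in the (sup) metric of `𝕋³`. [folklore] -/
theorem dist_corner_le {m : ℕ} (hm : 0 < m) (x : T3) :
    dist x (fun i : Fin 3 => ((((⌊(m : ℝ) * Torus.repr x i⌋₊ : ℝ) / m : ℝ) : UnitAddCircle))) ≤ 1 / m := by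
  refine (dist_pi_le_iff (by positivity)).2 fun i => ?_
  rw [dist_eq_norm]
  exact norm_sub_corner_le hm x i

/-- **Uniform continuity on the compact torus** (Heine–Cantor), in `ε`–`δ` form for a continuous map
into a metric space. [folklore] -/
theorem exists_forall_dist_lt_of_continuous {β : Type*} [PseudoMetricSpace β] {f : T3 → β}
    (hf : Continuous f) {ε : ℝ} (hε : 0 < ε) :
    ∃ δ : ℝ, 0 < δ ∧ ∀ x y : T3, dist x y < δ → dist (f x) (f y) < ε := by
  have h := Metric.uniformContinuous_iff.1 (CompactSpace.uniformContinuous_of_continuous hf) ε hε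
  obtain ⟨δ, hδ, hδ'⟩ := h
  exact ⟨δ, hδ, fun x y hxy => hδ' hxy⟩

/-- A continuous positive function on `𝕋³` is bounded below by a positive constant. [folklore] -/
theorem exists_pos_forall_le_of_continuous {f : T3 → ℝ} (hf : Continuous f) (hf0 : ∀ x, 0 < f x) :
    ∃ c : ℝ, 0 < c ∧ ∀ x, c ≤ f x := by
  obtain ⟨x₀, -, hx₀⟩ := isCompact_univ.exists_isMinOn univ_nonempty hf.continuousOn
  exact ⟨f x₀, hf0 x₀, fun x => hx₀ (mem_univ x)⟩

/-! ## The pointwise decomposition of the log-ratio of two local Gibbs profiles -/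

/-- For positive parameters, `log prof₁(x,v) − log prof₂(x,v) =
(log a₁ − log a₂) + 3/2 (log θ₂ − log θ₁) + ‖v − u₂‖²/(2θ₂) − ‖v − u₁‖²/(2θ₁)` (at the point `x`).
[folklore] -/
theorem log_localGibbsProfile_sub {a₁ θ₁ a₂ θ₂ : T3 → ℝ} {u₁ u₂ : T3 → V3} (x : T3) (v : V3)
    (ha₁ : 0 < a₁ x) (hθ₁ : 0 < θ₁ x) (ha₂ : 0 < a₂ x) (hθ₂ : 0 < θ₂ x) :
    Real.log (localGibbsProfile a₁ u₁ θ₁ (x, v)) - Real.log (localGibbsProfile a₂ u₂ θ₂ (x, v)) =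
      (Real.log (a₁ x) - Real.log (a₂ x)) + 3 / 2 * (Real.log (θ₂ x) - Real.log (θ₁ x)) +
        (2 * θ₂ x)⁻¹ * ‖v - u₂ x‖ ^ 2 - (2 * θ₁ x)⁻¹ * ‖v - u₁ x‖ ^ 2 := by
  rw [MacroClosureLine.StubLedger.log_localGibbsProfile_eq x v ha₁ hθ₁,
    MacroClosureLine.StubLedger.log_localGibbsProfile_eq x v ha₂ hθ₂,
    Real.log_rpow (mul_pos (mul_pos two_pos Real.pi_pos) hθ₁),
    Real.log_rpow (mul_pos (mul_pos two_pos Real.pi_pos) hθ₂), finrank_euclideanSpace_fin,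
    Real.log_mul (mul_pos two_pos Real.pi_pos).ne' hθ₁.ne', Real.log_mul (mul_pos two_pos Real.pi_pos).ne' hθ₂.ne']
  push_cast
  rw [div_eq_inv_mul (‖v - u₁ x‖ ^ 2), div_eq_inv_mul (‖v - u₂ x‖ ^ 2)]
  ring

/-! ## Two elementary estimates -/

/-- `log θb − log θ ≤ η / θ_min` when `0 < θ_min ≤ θ`, `0 < θb` and `θb − θ ≤ η`. [folklore] -/
theorem log_sub_log_le_of_sub_le {θmin η θ θb : ℝ} (hθmin : 0 < θmin) (hη : 0 ≤ η) (hθ : θmin ≤ θ)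
    (hθb : 0 < θb) (hd : θb - θ ≤ η) : Real.log θb - Real.log θ ≤ η / θmin := by
  have hθpos : 0 < θ := hθmin.trans_le hθ
  rw [← Real.log_div hθb.ne' hθpos.ne']
  refine (Real.log_le_sub_one_of_pos (div_pos hθb hθpos)).trans ?_
  rw [div_sub_one hθpos.ne', div_le_div_iff₀ hθpos hθmin]
  calc (θb - θ) * θmin ≤ η * θmin := mul_le_mul_of_nonneg_right hd hθmin.le
    _ ≤ η * θ := mul_le_mul_of_nonneg_left hθ hη

/-- The per-particle Gaussian cost of a nearby block reference:
`(2θb)⁻¹ (3θ + d) ≤ 3/2 + 4η/θ_min` when `θ ≤ θb + η`, `0 ≤ d ≤ η² ≤ η`, `θ_min/2 ≤ θb`. [folklore] -/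
theorem weightBound_of_close {θmin η θ θb d : ℝ} (hθmin : 0 < θmin) (hη : 0 ≤ η) (hη1 : η ≤ 1)
    (hθb : θmin / 2 ≤ θb) (hθ : θ ≤ θb + η) (hd : d ≤ η ^ 2) :
    (2 * θb)⁻¹ * (3 * θ + d) ≤ 3 / 2 + 4 * η / θmin := by
  have hθbpos : 0 < θb := by linarith
  have hη2 : η ^ 2 ≤ η := by nlinarith
  rw [inv_mul_le_iff₀ (by linarith)]
  have hratio : 1 / 2 ≤ θb / θmin := by rw [le_div_iff₀ hθmin]; linarith
  have h8 : 8 * η * (1 / 2) ≤ 8 * η * (θb / θmin) := mul_le_mul_of_nonneg_left hratio (by linarith)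
  have hrhs : (2 * θb) * (3 / 2 + 4 * η / θmin) = 3 * θb + 8 * η * (θb / θmin) := by
    field_simp
    ring
  rw [hrhs]
  linarith

end Summit.AtomisticToContinuum.HydrodynamicLimit.Theorems.BlockGibbsLine

end
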